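import Literature.MathematicalPhysics.KineticTheory.HardSphereEulerLLN

/-!
# Perturbation of the cluster-series one-point limit in the density profile

Helper file for the support item `UniformLocalGibbsConcentration` (routes `OneFlightGossipEngine`, `TwoClocks`)
(stmt-AtomisticToContinuum-14445): for two density profiles `P`, `Q` on `𝕋³` whose densities are
uniformly close, `|β_Q - β_P| ≤ ω`, and whose common smallness parameter
`η = e · M⋆ · v₁ · σ³` (`P.M, Q.M ≤ M⋆`) is at most `1/32`, the limit one-point functional
`Ilim X σ χ = ∑_j γ_j (∫ χ β_X^{j+1}) R_X^{j+1}` of `HardSphereEulerLLN` is Lipschitz in the profile: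

* `abs_coefLim_sub_le` : `|coefLim Q σ g j - coefLim P σ g j| ≤ e C ω (j+1) ηʲ`;
* `abs_ratioSeries_sub_le` : `|F_Q(R) - F_P(R)| ≤ e ω / (1 - 2η)²` on `|R| ≤ 2`;
* `abs_sub_le_two_mul_abs_rootFn_sub` : the map `R ↦ R F_P(R)` is `1/2`-coercive on `[-2, 2]`
  (so its root `ratioLimit P σ ∈ [1/2, 2]` is stable);
* `abs_ratioLimit_sub_le` : `|R_Q - R_P| ≤ 4 e ω / (1 - 2η)²`;
* `abs_Ilim_sub_le` : `|Ilim Q σ χ - Ilim P σ χ| ≤ e C (2ω + 4eω/(1-2η)²) / (1-2η)²`.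

Also `smallDensity_of_eta_le`: `η ≤ 1/32` (with `0 < σ < 1/2`) implies the smallness package
`SmallDensity X σ` of `HardSphereEulerRatio` for every profile `X` with `X.M ≤ M⋆`.
All proofs are termwise comparisons with the geometric majorants of the tree
(`abs_coefLim_le`, `abs_clusterCoeff_le`) and `∑ (j+1) θʲ = (1-θ)⁻²`.
-/

noncomputable section

namespace Summit.AtomisticToContinuum.HydrodynamicLimit.Theorems

namespace UniformLGC

open MeasureTheory Filter Set Topology
open Literature.MathematicalPhysics.KineticTheory

/-! ### Elementary inequalities -/

/-- `|x^{n+1} - y^{n+1}| ≤ (n+1) Mⁿ |x - y|` for `|x|, |y| ≤ M`. -/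
theorem abs_pow_succ_sub_le {x y M : ℝ} (hx : |x| ≤ M) (hy : |y| ≤ M) (n : ℕ) :
    |x ^ (n + 1) - y ^ (n + 1)| ≤ (n + 1) * M ^ n * |x - y| := by
  have hM : 0 ≤ M := (abs_nonneg x).trans hx
  have h := abs_pow_sub_pow_le x y (n + 1)
  have hmax : max |x| |y| ≤ M := max_le hx hy
  have hmax0 : 0 ≤ max |x| |y| := le_max_of_le_left (abs_nonneg x)
  calc |x ^ (n + 1) - y ^ (n + 1)| ≤ |x - y| * (n + 1 : ℕ) * max |x| |y| ^ (n + 1 - 1) := h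
    _ ≤ |x - y| * (n + 1 : ℕ) * M ^ n := by
        rw [Nat.add_sub_cancel]
        exact mul_le_mul_of_nonneg_left (pow_le_pow_left₀ hmax0 hmax n) (by positivity)
    _ = (n + 1) * M ^ n * |x - y| := by push_cast; ring

/-- `∑ (j+1) θʲ = (1-θ)⁻²` for `0 ≤ θ < 1`. -/
theorem hasSum_succ_mul_pow {θ : ℝ} (hθ0 : 0 ≤ θ) (hθ1 : θ < 1) :
    HasSum (fun j : ℕ => ((j : ℝ) + 1) * θ ^ j) (1 / (1 - θ) ^ 2) := by
  have h1 := hasSum_coe_mul_geometric_of_norm_lt_one (𝕜 := ℝ) (r := θ)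
    (by rw [Real.norm_eq_abs, abs_of_nonneg hθ0]; exact hθ1)
  have h2 := hasSum_geometric_of_lt_one hθ0 hθ1
  have hne : (1 - θ) ≠ 0 := by linarith
  have hval : θ / (1 - θ) ^ 2 + (1 - θ)⁻¹ = 1 / (1 - θ) ^ 2 := by
    field_simp
    ring
  rw [← hval]
  refine (h1.add h2).congr_fun fun j => ?_
  ring

/-- The shifted majorant: `∑ (j+2) θ^{j+1} = (1-θ)⁻² - 1` for `0 ≤ θ < 1`. -/
theorem hasSum_succ_succ_mul_pow_succ {θ : ℝ} (hθ0 : 0 ≤ θ) (hθ1 : θ < 1) :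
    HasSum (fun j : ℕ => ((j : ℝ) + 2) * θ ^ (j + 1)) (1 / (1 - θ) ^ 2 - 1) := by
  have h := hasSum_succ_mul_pow hθ0 hθ1
  have h' := (hasSum_nat_add_iff (f := fun j : ℕ => ((j : ℝ) + 1) * θ ^ j) 1
    (g := 1 / (1 - θ) ^ 2 - 1)).mpr (by
      simpa [Finset.sum_range_one] using h)
  refine h'.congr_fun fun j => ?_
  push_cast
  ring

/-! ### The smallness regime `η = e M⋆ v₁ σ³ ≤ 1/32` -/

section Regime

variable {P Q : DensityProfile} {σ Mstar : ℝ}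

/-- `geomRatio X σ ≤ 2η` when `X.M ≤ M⋆` (`η = e M⋆ v₁ σ³`). -/
theorem geomRatio_le_of_M_le (hσ : 0 ≤ σ) (hM : P.M ≤ Mstar) :
    geomRatio P σ ≤ 2 * (Real.exp 1 * (Mstar * v₁ * σ ^ 3)) := by
  rw [geomRatio, ovDensity]
  have hv := v₁_pos.le
  have hσ3 : 0 ≤ σ ^ 3 := pow_nonneg hσ 3
  have he := (Real.exp_pos 1).le
  have : P.M * v₁ * σ ^ 3 ≤ Mstar * v₁ * σ ^ 3 := by gcongr
  nlinarith

/-- `e · ovDensity X σ ≤ η` when `X.M ≤ M⋆`. -/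
theorem exp_mul_ovDensity_le_of_M_le (hσ : 0 ≤ σ) (hM : P.M ≤ Mstar) :
    Real.exp 1 * ovDensity P σ ≤ Real.exp 1 * (Mstar * v₁ * σ ^ 3) := by
  rw [ovDensity]
  have hv := v₁_pos.le
  have hσ3 : 0 ≤ σ ^ 3 := pow_nonneg hσ 3
  gcongr

/-- **The smallness package from `η ≤ 1/32`.** For `0 < σ < 1/2` and a profile `X` with
`X.M ≤ M⋆`, `e M⋆ v₁ σ³ ≤ 1/32` implies `SmallDensity X σ` (all conditions of `HardSphereEulerRatio`
are monotone in `θ = geomRatio X σ ≤ 1/16`). -/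
theorem smallDensity_of_eta_le (hσ : 0 < σ) (hσ2 : σ < 1 / 2) (hM : P.M ≤ Mstar)
    (hη : Real.exp 1 * (Mstar * v₁ * σ ^ 3) ≤ 1 / 32) : SmallDensity P σ := by
  have he1 : Real.exp 1 < 2.7182818286 := Real.exp_one_lt_d9
  have he0 : 0 < Real.exp 1 := Real.exp_pos 1
  have he_ge : 1 ≤ Real.exp 1 := by have := Real.add_one_le_exp (1 : ℝ); linarith
  have hθ : geomRatio P σ ≤ 1 / 16 := (geomRatio_le_of_M_le hσ.le hM).trans (by linarith)
  have hθ0 : 0 ≤ geomRatio P σ := geomRatio_nonneg hσ.le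
  have hlam : ovDensity P σ ≤ 1 / 2 := by
    have h1 := exp_mul_ovDensity_le_of_M_le (P := P) hσ.le hM
    have h2 : ovDensity P σ ≤ Real.exp 1 * ovDensity P σ :=
      le_mul_of_one_le_left (ovDensity_nonneg hσ.le) he_ge
    linarith
  have h1θ : 15 / 16 ≤ 1 - geomRatio P σ := by linarith
  have hphi : Real.exp 1 * geomRatio P σ / (1 - geomRatio P σ) < 1 / 2 := by
    rw [div_lt_iff₀ (by linarith)]
    nlinarith
  have hκ : 4 * contractionC P σ < 1 := by
    rw [contractionC]
    have hden : (15 / 16 : ℝ) ^ 2 ≤ (1 - geomRatio P σ) ^ 2 := pow_le_pow_left₀ (by norm_num) h1θ 2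
    have hnum : Real.exp 1 * geomRatio P σ ≤ Real.exp 1 * (1 / 16) := by gcongr
    have hfrac : Real.exp 1 * geomRatio P σ / (1 - geomRatio P σ) ^ 2 ≤
        Real.exp 1 * (1 / 16) / (15 / 16 : ℝ) ^ 2 :=
      div_le_div₀ (by positivity) hnum (by norm_num) hden
    have h64 : 4 * (Real.exp 1 * (1 / 16) / (15 / 16 : ℝ) ^ 2) = Real.exp 1 * (64 / 225) := by ring
    have : Real.exp 1 * (64 / 225) < 1 := by nlinarith
    linarith
  exact ⟨hσ, hσ2, hlam, by linarith, hphi, hκ⟩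

end Regime

/-! ### Perturbation of the coefficients -/

section Perturbation

variable {P Q : DensityProfile} {σ Mstar ω : ℝ}

/-- **Moment perturbation**: `|∫ g β_Q^{j+1} - ∫ g β_P^{j+1}| ≤ C (j+1) M⋆ʲ ω` for continuous
`|g| ≤ C`, `|β_Q - β_P| ≤ ω` and `P.M, Q.M ≤ M⋆`. -/
theorem abs_integral_pow_sub_le {g : T3 → ℝ} (hg : Continuous g) {C : ℝ} (hgC : ∀ y, |g y| ≤ C)
    (hMP : P.M ≤ Mstar) (hMQ : Q.M ≤ Mstar) (hω : ∀ y, |Q.β y - P.β y| ≤ ω) (j : ℕ) :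
    |(∫ y, g y * Q.β y ^ (j + 1)) - ∫ y, g y * P.β y ^ (j + 1)| ≤ C * ((j + 1) * Mstar ^ j * ω) := by
  have hC : 0 ≤ C := (abs_nonneg _).trans (hgC 0)
  have hiQ : Integrable (fun y => g y * Q.β y ^ (j + 1)) :=
    integrable_of_continuous_T3 (hg.mul (Q.continuous.pow _))
  have hiP : Integrable (fun y => g y * P.β y ^ (j + 1)) :=
    integrable_of_continuous_T3 (hg.mul (P.continuous.pow _))
  rw [← integral_sub hiQ hiP]
  have hpt : ∀ y, |g y * Q.β y ^ (j + 1) - g y * P.β y ^ (j + 1)| ≤ C * ((j + 1) * Mstar ^ j * ω) := by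
    intro y
    have hβQ : |Q.β y| ≤ Mstar := by rw [abs_of_pos (Q.pos y)]; exact (Q.le_M y).trans hMQ
    have hβP : |P.β y| ≤ Mstar := by rw [abs_of_pos (P.pos y)]; exact (P.le_M y).trans hMP
    have hpow := abs_pow_succ_sub_le hβQ hβP j
    have hM0 : 0 ≤ Mstar := (abs_nonneg _).trans hβQ
    rw [← mul_sub, abs_mul]
    refine mul_le_mul (hgC y) (hpow.trans ?_) (abs_nonneg _) hC
    exact mul_le_mul_of_nonneg_left (hω y) (by positivity)
  calc |∫ y, g y * Q.β y ^ (j + 1) - g y * P.β y ^ (j + 1)|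
      ≤ ∫ y, |g y * Q.β y ^ (j + 1) - g y * P.β y ^ (j + 1)| := abs_integral_le_integral_abs
    _ ≤ ∫ _ : T3, C * ((j + 1) * Mstar ^ j * ω) :=
        integral_mono (hiQ.sub hiP).abs (integrable_const _) hpt
    _ = C * ((j + 1) * Mstar ^ j * ω) := by simp

/-- **Coefficient perturbation**: `|coefLim Q σ g j - coefLim P σ g j| ≤ e C ω (j+1) ηʲ`,
`η = e M⋆ v₁ σ³`. -/
theorem abs_coefLim_sub_le (hσ : 0 < σ) (hσ2 : σ < 1 / 2) {g : T3 → ℝ} (hg : Continuous g)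
    {C : ℝ} (hgC : ∀ y, |g y| ≤ C) (hMP : P.M ≤ Mstar) (hMQ : Q.M ≤ Mstar)
    (hω : ∀ y, |Q.β y - P.β y| ≤ ω) (j : ℕ) :
    |coefLim Q σ g j - coefLim P σ g j| ≤
      Real.exp 1 * C * ω * (((j : ℝ) + 1) * (Real.exp 1 * (Mstar * v₁ * σ ^ 3)) ^ j) := by
  have hC : 0 ≤ C := (abs_nonneg _).trans (hgC 0)
  have hω0 : 0 ≤ ω := (abs_nonneg _).trans (hω 0)
  have hM0 : 0 ≤ Mstar := P.M_pos.le.trans hMP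
  have hγ := abs_clusterCoeff_le hσ hσ2 j
  have hI := abs_integral_pow_sub_le hg hgC hMP hMQ hω j
  have hv := v₁_pos.le
  rw [coefLim, coefLim, ← mul_sub, abs_mul]
  calc |clusterCoeff σ j| * |(∫ y, g y * Q.β y ^ (j + 1)) - ∫ y, g y * P.β y ^ (j + 1)|
      ≤ (Real.exp 1 * (Real.exp 1 * (v₁ * σ ^ 3)) ^ j) * (C * ((j + 1) * Mstar ^ j * ω)) :=
        mul_le_mul hγ hI (abs_nonneg _) (by positivity)
    _ = Real.exp 1 * C * ω * (((j : ℝ) + 1) * (Real.exp 1 * (Mstar * v₁ * σ ^ 3)) ^ j) := by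
        rw [mul_pow, mul_pow, mul_pow, mul_pow]; ring

/-- **Perturbation of the limit recursion series**: `|F_Q(R) - F_P(R)| ≤ e ω / (1 - 2η)²` for
`|R| ≤ 2` (`F_X = ratioSeries X σ`), when `η ≤ 1/32`. -/
theorem abs_ratioSeries_sub_le (hσ : 0 < σ) (hσ2 : σ < 1 / 2) (hMP : P.M ≤ Mstar)
    (hMQ : Q.M ≤ Mstar) (hη : Real.exp 1 * (Mstar * v₁ * σ ^ 3) ≤ 1 / 32)
    (hω : ∀ y, |Q.β y - P.β y| ≤ ω) {R : ℝ} (hR : |R| ≤ 2) :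
    |ratioSeries Q σ R - ratioSeries P σ R| ≤
      Real.exp 1 * ω / (1 - 2 * (Real.exp 1 * (Mstar * v₁ * σ ^ 3))) ^ 2 := by
  set η := Real.exp 1 * (Mstar * v₁ * σ ^ 3) with hηdef
  have hM0 : 0 ≤ Mstar := P.M_pos.le.trans hMP
  have hη0 : 0 ≤ η := by have := v₁_pos.le; have := (Real.exp_pos 1).le; positivity
  have h2η1 : 2 * η < 1 := by linarith
  have hθP : geomRatio P σ < 1 := lt_of_le_of_lt (geomRatio_le_of_M_le hσ.le hMP) h2η1
  have hθQ : geomRatio Q σ < 1 := lt_of_le_of_lt (geomRatio_le_of_M_le hσ.le hMQ) h2η1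
  have hsP := summable_ratioSeries (P := P) hσ hσ2 hθP hR
  have hsQ := summable_ratioSeries (P := Q) hσ hσ2 hθQ hR
  rw [ratioSeries, ratioSeries, ← hsQ.tsum_sub hsP]
  have hω0 : 0 ≤ ω := (abs_nonneg _).trans (hω 0)
  have hmaj : HasSum (fun j : ℕ => Real.exp 1 * ω * (((j : ℝ) + 1) * (2 * η) ^ j))
      (Real.exp 1 * ω / (1 - 2 * η) ^ 2) := by
    have h := (hasSum_succ_mul_pow (by positivity) h2η1).mul_left (Real.exp 1 * ω)
    rwa [← mul_div_assoc, mul_one] at h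
  refine (Real.norm_eq_abs _).symm.trans_le (tsum_of_norm_bounded hmaj fun j => ?_)
  rw [Real.norm_eq_abs, ← sub_mul, abs_mul, abs_pow]
  have hc := abs_coefLim_sub_le hσ hσ2 (g := fun _ => (1 : ℝ)) continuous_const (C := 1)
    (fun _ => by simp) hMP hMQ hω j
  rw [mul_one] at hc
  calc |coefLim Q σ (fun _ => 1) j - coefLim P σ (fun _ => 1) j| * |R| ^ j
      ≤ (Real.exp 1 * ω * (((j : ℝ) + 1) * η ^ j)) * 2 ^ j :=
        mul_le_mul hc (pow_le_pow_left₀ (abs_nonneg _) hR j) (by positivity) (by positivity)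
    _ = Real.exp 1 * ω * (((j : ℝ) + 1) * (2 * η) ^ j) := by rw [mul_pow]; ring

/-- **Coercivity of the limit recursion**: for `|R₁|, |R₂| ≤ 2` and `η ≤ 1/32` (any profile `P`
with `P.M ≤ M⋆`), `|R₁ - R₂| ≤ 2 |R₁ F_P(R₁) - R₂ F_P(R₂)|` — the `j ≥ 1` part of
`R F_P(R) = R + ∑_{j≥1} γ_j (∫β^{j+1}) R^{j+1}` is `e((1-2η)⁻² - 1) ≤ 1/2`-Lipschitz. -/
theorem abs_sub_le_two_mul_abs_rootFn_sub (hσ : 0 < σ) (hσ2 : σ < 1 / 2) (hMP : P.M ≤ Mstar)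
    (hη : Real.exp 1 * (Mstar * v₁ * σ ^ 3) ≤ 1 / 32) {R₁ R₂ : ℝ} (hR₁ : |R₁| ≤ 2) (hR₂ : |R₂| ≤ 2) :
    |R₁ - R₂| ≤ 2 * |R₁ * ratioSeries P σ R₁ - R₂ * ratioSeries P σ R₂| := by
  set η := Real.exp 1 * (Mstar * v₁ * σ ^ 3) with hηdef
  have he1 : Real.exp 1 < 2.7182818286 := Real.exp_one_lt_d9
  have he0 : 0 < Real.exp 1 := Real.exp_pos 1
  have hM0 : 0 ≤ Mstar := P.M_pos.le.trans hMP
  have hη0 : 0 ≤ η := by have := v₁_pos.le; positivity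
  have h2η1 : 2 * η < 1 := by linarith
  have hθP : geomRatio P σ < 1 := lt_of_le_of_lt (geomRatio_le_of_M_le hσ.le hMP) h2η1
  have hs₁ := summable_ratioSeries (P := P) hσ hσ2 hθP hR₁
  have hs₂ := summable_ratioSeries (P := P) hσ hσ2 hθP hR₂
  -- `R F(R) = ∑ c_j R^{j+1}`
  set c : ℕ → ℝ := fun j => coefLim P σ (fun _ => 1) j with hc
  have hG : ∀ {R : ℝ}, Summable (fun j => c j * R ^ j) →
      R * ratioSeries P σ R = ∑' j, c j * R ^ (j + 1) := by
    intro R hs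
    rw [ratioSeries, ← tsum_mul_left]
    exact tsum_congr fun j => by rw [hc]; ring
  have hs₁' : Summable fun j => c j * R₁ ^ (j + 1) := by
    simpa [pow_succ, ← mul_assoc] using hs₁.mul_right R₁
  have hs₂' : Summable fun j => c j * R₂ ^ (j + 1) := by
    simpa [pow_succ, ← mul_assoc] using hs₂.mul_right R₂
  have hdiff : R₁ * ratioSeries P σ R₁ - R₂ * ratioSeries P σ R₂ =
      (R₁ - R₂) + ∑' j, c (j + 1) * (R₁ ^ (j + 2) - R₂ ^ (j + 2)) := by
    rw [hG hs₁, hG hs₂, ← hs₁'.tsum_sub hs₂']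
    have hs : Summable fun j => c j * R₁ ^ (j + 1) - c j * R₂ ^ (j + 1) := hs₁'.sub hs₂'
    rw [hs.tsum_eq_zero_add]
    have hc0 : c 0 = 1 := by rw [hc]; exact coefLim_one_zero hσ
    congr 1
    · rw [hc0]; ring
    · exact tsum_congr fun j => by ring
  -- the tail is `≤ e((1-2η)⁻² - 1) |R₁ - R₂| ≤ |R₁ - R₂| / 2`
  have hcj : ∀ j, |c j| ≤ Real.exp 1 * η ^ j := by
    intro j
    have h := abs_coefLim_le (P := P) hσ hσ2 (g := fun _ => (1 : ℝ)) measurable_const (C := 1)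
      (fun _ => by simp) j
    rw [one_mul] at h
    refine h.trans ?_
    have := exp_mul_ovDensity_le_of_M_le (P := P) hσ.le hMP
    have h0 : 0 ≤ Real.exp 1 * ovDensity P σ := by have := ovDensity_nonneg (P := P) hσ.le; positivity
    gcongr
  have hmaj : HasSum (fun j : ℕ => Real.exp 1 * |R₁ - R₂| * (((j : ℝ) + 2) * (2 * η) ^ (j + 1)))
      (Real.exp 1 * |R₁ - R₂| * (1 / (1 - 2 * η) ^ 2 - 1)) :=
    (hasSum_succ_succ_mul_pow_succ (by positivity) h2η1).mul_left _
  have htail : |∑' j, c (j + 1) * (R₁ ^ (j + 2) - R₂ ^ (j + 2))| ≤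
      Real.exp 1 * |R₁ - R₂| * (1 / (1 - 2 * η) ^ 2 - 1) := by
    refine (Real.norm_eq_abs _).symm.trans_le (tsum_of_norm_bounded hmaj fun j => ?_)
    rw [Real.norm_eq_abs, abs_mul]
    have hpow := abs_pow_succ_sub_le hR₁ hR₂ (j + 1)
    calc |c (j + 1)| * |R₁ ^ (j + 2) - R₂ ^ (j + 2)|
        ≤ (Real.exp 1 * η ^ (j + 1)) * (((j + 1 : ℕ) + 1) * 2 ^ (j + 1) * |R₁ - R₂|) :=
          mul_le_mul (hcj (j + 1)) hpow (abs_nonneg _) (by positivity)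
      _ = Real.exp 1 * |R₁ - R₂| * (((j : ℝ) + 2) * (2 * η) ^ (j + 1)) := by
          push_cast; rw [mul_pow]; ring
  have hsmall : Real.exp 1 * (1 / (1 - 2 * η) ^ 2 - 1) ≤ 1 / 2 := by
    have h1 : 15 / 16 ≤ 1 - 2 * η := by linarith
    have h2 : (15 / 16 : ℝ) ^ 2 ≤ (1 - 2 * η) ^ 2 := pow_le_pow_left₀ (by norm_num) h1 2
    have h3 : 1 / (1 - 2 * η) ^ 2 ≤ 1 / (15 / 16 : ℝ) ^ 2 :=
      one_div_le_one_div_of_le (by norm_num) h2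
    nlinarith
  have key : |R₁ * ratioSeries P σ R₁ - R₂ * ratioSeries P σ R₂ - (R₁ - R₂)| ≤ |R₁ - R₂| / 2 := by
    rw [hdiff, add_sub_cancel_left]
    refine htail.trans ?_
    have := abs_nonneg (R₁ - R₂)
    nlinarith
  have := abs_sub_abs_le_abs_sub (R₁ - R₂) (R₁ * ratioSeries P σ R₁ - R₂ * ratioSeries P σ R₂)
  rw [abs_sub_comm] at key
  linarith

/-- **Stability of the limit ratio**: `|R_Q - R_P| ≤ 4 e ω / (1 - 2η)²` (`R_X = ratioLimit X σ`,
the root in `[1/2, 2]` of `R F_X(R) = 1`), when `η ≤ 1/32` and `|β_Q - β_P| ≤ ω`. -/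
theorem abs_ratioLimit_sub_le (hP : SmallDensity P σ) (hQ : SmallDensity Q σ) (hMP : P.M ≤ Mstar)
    (hMQ : Q.M ≤ Mstar) (hη : Real.exp 1 * (Mstar * v₁ * σ ^ 3) ≤ 1 / 32)
    (hω : ∀ y, |Q.β y - P.β y| ≤ ω) :
    |ratioLimit Q σ - ratioLimit P σ| ≤
      4 * (Real.exp 1 * ω / (1 - 2 * (Real.exp 1 * (Mstar * v₁ * σ ^ 3))) ^ 2) := by
  have hRP := hP.abs_ratioLimit_le
  have hRQ := hQ.abs_ratioLimit_le
  have hspecP := (ratioLimit_spec (P := P) hP.σ_pos hP.σ_lt_half hP.geomRatio_lt_one hP.phi_lt_half).2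
  have hspecQ := (ratioLimit_spec (P := Q) hQ.σ_pos hQ.σ_lt_half hQ.geomRatio_lt_one hQ.phi_lt_half).2
  have hco := abs_sub_le_two_mul_abs_rootFn_sub (P := P) hP.σ_pos hP.σ_lt_half hMP hη hRQ hRP
  have hF := abs_ratioSeries_sub_le (P := P) (Q := Q) hP.σ_pos hP.σ_lt_half hMP hMQ hη hω hRQ
  have heq : ratioLimit Q σ * ratioSeries P σ (ratioLimit Q σ) - ratioLimit P σ * ratioSeries P σ (ratioLimit P σ) =
      -(ratioLimit Q σ * (ratioSeries Q σ (ratioLimit Q σ) - ratioSeries P σ (ratioLimit Q σ))) := by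
    rw [hspecP, mul_sub, hspecQ]; ring
  rw [heq, abs_neg, abs_mul] at hco
  calc |ratioLimit Q σ - ratioLimit P σ|
      ≤ 2 * (|ratioLimit Q σ| * |ratioSeries Q σ (ratioLimit Q σ) - ratioSeries P σ (ratioLimit Q σ)|) := hco
    _ ≤ 2 * (2 * (Real.exp 1 * ω / (1 - 2 * (Real.exp 1 * (Mstar * v₁ * σ ^ 3))) ^ 2)) := by
        gcongr
    _ = _ := by ring

/-- **Perturbation of the one-point limit**: for continuous `|χ| ≤ C`,
`|Ilim Q σ χ - Ilim P σ χ| ≤ e C (2ω + 4eω/(1-2η)²) / (1-2η)²` when `η ≤ 1/32` and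
`|β_Q - β_P| ≤ ω`. -/
theorem abs_Ilim_sub_le (hP : SmallDensity P σ) (hQ : SmallDensity Q σ) (hMP : P.M ≤ Mstar)
    (hMQ : Q.M ≤ Mstar) (hη : Real.exp 1 * (Mstar * v₁ * σ ^ 3) ≤ 1 / 32)
    (hω : ∀ y, |Q.β y - P.β y| ≤ ω) {χ : T3 → ℝ} (hχ : Continuous χ) {C : ℝ} (hχC : ∀ y, |χ y| ≤ C) :
    |Ilim Q σ χ - Ilim P σ χ| ≤
      Real.exp 1 * C * (2 * ω + 4 * (Real.exp 1 * ω / (1 - 2 * (Real.exp 1 * (Mstar * v₁ * σ ^ 3))) ^ 2)) /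
        (1 - 2 * (Real.exp 1 * (Mstar * v₁ * σ ^ 3))) ^ 2 := by
  set η := Real.exp 1 * (Mstar * v₁ * σ ^ 3) with hηdef
  set D := |ratioLimit Q σ - ratioLimit P σ| with hD
  have he0 : 0 < Real.exp 1 := Real.exp_pos 1
  have hσ := hP.σ_pos
  have hσ2 := hP.σ_lt_half
  have hM0 : 0 ≤ Mstar := P.M_pos.le.trans hMP
  have hη0 : 0 ≤ η := by have := v₁_pos.le; positivity
  have h2η1 : 2 * η < 1 := by linarith
  have hC : 0 ≤ C := (abs_nonneg _).trans (hχC 0)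
  have hω0 : 0 ≤ ω := (abs_nonneg _).trans (hω 0)
  have hχm : Measurable χ := hχ.measurable
  have hsP := hP.summable_Ilim hχm hχC
  have hsQ := hQ.summable_Ilim hχm hχC
  have hRP := hP.abs_ratioLimit_le
  have hRQ := hQ.abs_ratioLimit_le
  have hDle : D ≤ 4 * (Real.exp 1 * ω / (1 - 2 * η) ^ 2) := abs_ratioLimit_sub_le hP hQ hMP hMQ hη hω
  rw [Ilim, Ilim, ← hsQ.tsum_sub hsP]
  -- termwise bound `e C (j+1) (2η)^j (2ω + D)`
  have hmaj : HasSum (fun j : ℕ => Real.exp 1 * C * (2 * ω + D) * (((j : ℝ) + 1) * (2 * η) ^ j))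
      (Real.exp 1 * C * (2 * ω + D) * (1 / (1 - 2 * η) ^ 2)) :=
    (hasSum_succ_mul_pow (by positivity) h2η1).mul_left _
  have hbound : ‖∑' j, (coefLim Q σ χ j * ratioLimit Q σ ^ (j + 1) - coefLim P σ χ j * ratioLimit P σ ^ (j + 1))‖ ≤
      Real.exp 1 * C * (2 * ω + D) * (1 / (1 - 2 * η) ^ 2) := by
    refine tsum_of_norm_bounded hmaj fun j => ?_
    rw [Real.norm_eq_abs]
    have hsplit : coefLim Q σ χ j * ratioLimit Q σ ^ (j + 1) - coefLim P σ χ j * ratioLimit P σ ^ (j + 1) =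
        (coefLim Q σ χ j - coefLim P σ χ j) * ratioLimit Q σ ^ (j + 1) +
          coefLim P σ χ j * (ratioLimit Q σ ^ (j + 1) - ratioLimit P σ ^ (j + 1)) := by ring
    rw [hsplit]
    have h1 := abs_coefLim_sub_le (P := P) (Q := Q) hσ hσ2 hχ hχC hMP hMQ hω j
    have h2 : |ratioLimit Q σ ^ (j + 1)| ≤ 2 ^ (j + 1) := by
      rw [abs_pow]; exact pow_le_pow_left₀ (abs_nonneg _) hRQ _
    have h3 : |coefLim P σ χ j| ≤ C * (Real.exp 1 * η ^ j) := by
      refine (abs_coefLim_le (P := P) hσ hσ2 hχm hχC j).trans ?_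
      have := exp_mul_ovDensity_le_of_M_le (P := P) hσ.le hMP
      have h0 : 0 ≤ Real.exp 1 * ovDensity P σ := by have := ovDensity_nonneg (P := P) hσ.le; positivity
      gcongr
    have h4 : |ratioLimit Q σ ^ (j + 1) - ratioLimit P σ ^ (j + 1)| ≤ (j + 1) * 2 ^ j * D :=
      abs_pow_succ_sub_le hRQ hRP j
    calc |(coefLim Q σ χ j - coefLim P σ χ j) * ratioLimit Q σ ^ (j + 1) +
          coefLim P σ χ j * (ratioLimit Q σ ^ (j + 1) - ratioLimit P σ ^ (j + 1))|
        ≤ |coefLim Q σ χ j - coefLim P σ χ j| * |ratioLimit Q σ ^ (j + 1)| +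
            |coefLim P σ χ j| * |ratioLimit Q σ ^ (j + 1) - ratioLimit P σ ^ (j + 1)| := by
          refine (abs_add_le _ _).trans ?_
          rw [abs_mul, abs_mul]
      _ ≤ (Real.exp 1 * C * ω * (((j : ℝ) + 1) * η ^ j)) * 2 ^ (j + 1) +
            (C * (Real.exp 1 * η ^ j)) * ((j + 1) * 2 ^ j * D) := by
          exact add_le_add (mul_le_mul h1 h2 (abs_nonneg _) (by positivity))
            (mul_le_mul h3 h4 (abs_nonneg _) (by positivity))
      _ = Real.exp 1 * C * (2 * ω + D) * (((j : ℝ) + 1) * (2 * η) ^ j) := by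
          rw [mul_pow, pow_succ]; ring
  refine ((Real.norm_eq_abs _).symm.trans_le hbound).trans ?_
  rw [mul_one_div]
  have hden : 0 < (1 - 2 * η) ^ 2 := by positivity
  rw [div_le_div_iff_of_pos_right hden]
  have : 0 ≤ Real.exp 1 * C := by positivity
  nlinarith [hDle, this]

end Perturbation

end UniformLGC

end Summit.AtomisticToContinuum.HydrodynamicLimit.Theorems

end
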